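import Summits.QuantumFields.YangMills.Theorems.NPointIsotropy.Negative.TieLoadBearing
import Summits.QuantumFields.YangMills.Theorems.CurvatureBoostCovariance.Negative.Unbundled
import Summits.QuantumFields.YangMills.Theorems.MirrorModularBoostsCurvatureBoostCovarianceLevelGrowthLow
import Summits.QuantumFields.YangMills.Theorems.MirrorModularBoostsCurvatureBoostCovarianceOrbitAllAngles
import Literature.MathematicalPhysics.QuantumFieldTheory.SchwingerLimitInheritance
import Literature.MathematicalPhysics.QuantumFieldTheory.OSLorentzInvariance
import HarnessLib

/-!
# `NPointIsotropy` — the level-growth bet at levels `a ≥ 2` is NECESSARY under the radial kernel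
(line `complex-rotation-bandlimit`)

Support file for crux `stmt-QuantumFields-11686` (`PencilRigidity.NPointIsotropy`).  The core certificate of the line proves
the crux from three shared inputs (Step 0, the doubled orbit kernel, level growth at levels `a ≥ 2`).  This file records the
converse for the third input: the crux itself IMPLIES the level-growth statement for every family carrying the radial
two-point kernel.  Indeed the crux gives `PlanarInvariant S₁`; a witness `H` of `ΘF* ⊗ F` with `F` `e₀`-time-ordered is
off-diagonal, so its orbit function `θ ↦ 𝔖_{2a}(R_θ · H)` under the rotations of the `(x₀,x₁)`-plane (determinant one,
fixing `e₂`, `e₃`) is CONSTANT, and every non-zero layer of a trigonometric representation of a constant vanishes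
(`trigPoly_coeff_eq_zero_of_const`).  So, modulo Step 0 and the doubled orbit kernel, the level-growth bet is exactly as
strong as the crux.

* `levelGrowthHighRadial_of_nPointIsotropy` — `NPointIsotropy →` level growth at levels `a ≥ 2` under `W1`, `EightFrameRP`,
  `RadialKernel`.
[folklore]
-/

noncomputable section

namespace Summit.QuantumFields.YangMills.Theorems.NPointIsotropy.ComplexRotationBandlimit

open scoped BigOperators SchwartzMap
open MeasureTheory Filter Topology
open Literature.MathematicalPhysics.QuantumLattice Literature.MathematicalPhysics.AQFT
  Literature.MathematicalPhysics.QuantumFieldTheory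
open Summit.QuantumFields.YangMills.Theorems.NPointIsotropy.Negative (E4 RadialKernel nPointIsotropy_iff)
open Summit.QuantumFields.YangMills.Theorems.CurvatureBoostCovariance.Negative (EightFrameRP PlanarInvariant W1)
open Summit.QuantumFields.YangMills.Theorems.CurvatureBoostCovariance.BoostsInheritMirrors
  (trigPoly_coeff_eq_zero_of_const)
open Summit.QuantumFields.YangMills.Theorems.CurvatureBoostCovariance.BoostsInheritMirrors.OrbitBandlimit
  (det_planeRot planeRot_single_two planeRot_single_three)

/-- **Planar invariance from the crux, over arbitrary Borel instances.**  The crux is stated with the Borel σ-algebra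
`borel G` installed by `letI`; any `[MeasurableSpace G] [BorelSpace G]` coincides with it (`BorelSpace.measurable_eq`),
so the crux applies verbatim. [folklore] -/
theorem planarInvariant_of_nPointIsotropy
    (hNPI : Summit.QuantumFields.YangMills.Theses.PencilRigidity.NPointIsotropy)
    {G : Type} [Group G] [TopologicalSpace G] [IsTopologicalGroup G] [CompactSpace G] [MeasurableSpace G]
    [BorelSpace G] (hG : IsCompactSimpleLieGroup G) {r : LatticeRep G} {sch : SpeciesScheme (YMSpecies G)}
    {S₁ : SchwingerFamily E4} (hW : W1 r sch S₁) (h8 : EightFrameRP S₁) (hK : RadialKernel S₁) :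
    PlanarInvariant S₁ := by
  have hm : ‹MeasurableSpace G› = borel G := BorelSpace.measurable_eq
  subst hm
  exact (nPointIsotropy_iff.mp hNPI) G hG r sch S₁ hW h8 hK

/-- A layer index with `2 ≤ |k|` is non-zero. [folklore] -/
theorem ne_zero_of_two_le_abs {k : ℤ} (hk2 : 2 ≤ |k|) : k ≠ 0 := by
  rintro rfl
  rw [abs_zero] at hk2
  exact absurd hk2 (by norm_num)

/-- **The level-growth bet at levels `a ≥ 2` FOLLOWS from the crux under the radial kernel.**  From `NPointIsotropy` we get
`PlanarInvariant S₁` (`planarInvariant_of_nPointIsotropy`); the witness `H` of `ΘF* ⊗ F` is off-diagonal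
(`IsAppendTensorOf.isOffDiagonal_of_isTimeOrdered`), the plane rotations `R_θ = planeRot 0 θ` have determinant one and fix
`e₂`, `e₃` (`det_planeRot`, `planeRot_single_two`, `planeRot_single_three`), so the orbit function is constant and the layers
`k ≠ 0` — in particular `|k| ≥ 2` — of any trigonometric representation vanish (`trigPoly_coeff_eq_zero_of_const`).  The
induction hypothesis (planar invariance in degrees `≤ 2a − 2`), `2 ≤ a` and the compact support are carried and unused.
[folklore] -/
theorem levelGrowthHighRadial_of_nPointIsotropy : Summit.QuantumFields.YangMills.Theses.PencilRigidity.NPointIsotropy → ∀ (G : Type) [Group G] [TopologicalSpace G] [IsTopologicalGroup G] [CompactSpace G] [MeasurableSpace G] [BorelSpace G], Literature.MathematicalPhysics.QuantumFieldTheory.IsCompactSimpleLieGroup G → ∀ (r : Literature.MathematicalPhysics.QuantumFieldTheory.LatticeRep G) (sch : Literature.MathematicalPhysics.QuantumFieldTheory.SpeciesScheme (Literature.MathematicalPhysics.QuantumFieldTheory.YMSpecies G)) (S₁ : Literature.MathematicalPhysics.QuantumLattice.SchwingerFamily (EuclideanSpace ℝ (Fin 4))), Summit.QuantumFields.YangMills.Theorems.CurvatureBoostCovariance.Negative.W1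 r sch S₁ → Summit.QuantumFields.YangMills.Theorems.CurvatureBoostCovariance.Negative.EightFrameRP S₁ → Summit.QuantumFields.YangMills.Theorems.NPointIsotropy.Negative.RadialKernel S₁ → ∀ a : ℕ, 2 ≤ a → (∀ N : ℕ, N + 2 ≤ 2 * a → ∀ R : EuclideanSpace ℝ (Fin 4) ≃ₗᵢ[ℝ] EuclideanSpace ℝ (Fin 4), LinearMap.det (R.toLinearEquiv : EuclideanSpace ℝ (Fin 4) →ₗ[ℝ] EuclideanSpace ℝ (Fin 4)) = 1 → R (EuclideanSpace.single 2 1) = EuclideanSpace.single 2 1 → R (EuclideanSpace.single 3 1) = EuclideanSpace.single 3 1 → ∀ F : SchwartzMap (Fin N → EuclideanSpace ℝ (Fin 4)) ℂ, Literature.MathematicalPhysics.AQFT.IsOffDiagonal F → S₁ N (Literature.MathematicalPhysics.QuantumLattice.linActMulti R F) = S₁ N F) → ∀ (F : SchwartzMap (Fin a → EuclideanSpace ℝ (Fin 4)) ℂ), Literature.MathematicalPhysics.QuantumLattice.IsTimeOrdered F → HasCompactSupport (F : (Fin a → EuclideanSpace ℝ (Fin 4)) → ℂ) → ∀ H : SchwartzMap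 (Fin (a + a) → EuclideanSpace ℝ (Fin 4)) ℂ, Literature.MathematicalPhysics.QuantumLattice.IsAppendTensorOf H (Literature.MathematicalPhysics.QuantumLattice.osAdjoint F) F → ∀ (K : ℕ) (p : ℤ → ℂ), (∀ θ : ℝ, S₁ (a + a) (Literature.MathematicalPhysics.QuantumLattice.linActMulti (Literature.MathematicalPhysics.QuantumFieldTheory.planeRot (0 : Fin 3) θ) H) = ∑ k ∈ Finset.Icc (-(K : ℤ)) K, p k * Complex.exp (4 * (k : ℂ) * (θ : ℂ) * Complex.I)) → ∀ k ∈ Finset.Icc (-(K : ℤ)) K, 2 ≤ |k| → p k = 0 := by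
  intro hNPI G _ _ _ _ _ _ hG r sch S₁ hW h8 hK a _ _ F hF _ H hH K p hp k hk hk2
  have hPI : PlanarInvariant S₁ := planarInvariant_of_nPointIsotropy hNPI hG hW h8 hK
  have hHoff : IsOffDiagonal H := hH.isOffDiagonal_of_isTimeOrdered hF hF
  have hconst : ∀ θ : ℝ, S₁ (a + a) (linActMulti (planeRot (0 : Fin 3) θ) H) = S₁ (a + a) H := fun θ =>
    hPI (planeRot (0 : Fin 3) θ) (det_planeRot θ) (planeRot_single_two θ) (planeRot_single_three θ) (a + a) H hHoff
  exact trigPoly_coeff_eq_zero_of_const K p (S₁ (a + a) H) (fun θ => (hp θ).symm.trans (hconst θ)) k hk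
    (ne_zero_of_two_le_abs hk2)

end Summit.QuantumFields.YangMills.Theorems.NPointIsotropy.ComplexRotationBandlimit

end
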